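import Literature.NumberTheory.Automorphic.ArchEndoscopicCentralDescentValue      -- ★ p854794∕p854840∕p854868 (this seat): the UNSIGNED H-step law §5 (`C ≠ 0`) and the descent calculus
import Literature.NumberTheory.Automorphic.ArchRankOneLimitFormulaPartialSigned     -- (this seat) layer 1: `exists_tendsto_deriv_two_sin_smul_integral_integral_insert_neg` (`C < 0`)
import HarnessLib

/-!
# The central descent with values on `U(Φ₂)_∞`, SIGNED: the H-step constant is NEGATIVE at every complex place
# (Rogawski 1990 §8.2 Prop. 8.2.1 pp. 118–119, p. 123 «differs by a sign»; §14.5 Lemma 14.5.2 (b)(c) p. 238; Varadarajan 1989 §6.4 Thm 22)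

Topic `NumberTheory/Automorphic`; namespace `Literature.NumberTheory.Automorphic.UnitaryGroup`.  THEOREMS ONLY (no `def`, no instance, no notation, no axiom, no named fact, no `sorry`).
Cell `pub/hodgecm-mathlib`, Track B «K2-LIT» ∕ crux H413 = `stmt-HodgeConjecture-24833`, ENGINE E4 (socket #9; «signed #9» = #10♯, K2E4-p15 ★ p855349 ∕ ★ `K2E4ArchConstantSignWitness`);
layer 2 of the SIGN HALF (b) (K2E4-p15 22:42:28Z, K2E4-p09 ★ p855382 `HStepDataSigned.C_neg`); author K2E4-p13 (g0), 2026-09-03.  BY IMPORT over ★ `ArchEndoscopicCentralDescentValue`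
§5 (ED. 3, this seat): its two theorems are re-run TOKEN FOR TOKEN with `C ≠ 0 ↦ C < 0`, the constant being layer 1's
★ `exists_tendsto_deriv_two_sin_smul_integral_integral_insert_neg` carried UNCHANGED (the §5 proof only ever passes Harish-Chandra's constant through: the two `ε`-sheets at the moving
place contribute the SAME limit `C • V`, `ψ ↦ −ψ` being absorbed by `2 sin`); a separate module so that ★ §5 and its consumers (★ `K2E4ArchHStepLaw`, ★ `K2E4ArchHStepData`, the #9
assembler) are untouched.

* **`exists_const_tendsto_deriv_two_sin_smul_sum_integral_pi_neg`** — ★ §5 `exists_const_tendsto_deriv_two_sin_smul_sum_integral_pi` VERBATIM with `∃ C : ℝ, C < 0 ∧ …`.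
* **`exists_const_forall_tendsto_deriv_two_sin_smul_sum_integral_pi_neg`** — the every-place family form, `∀ w, C w < 0`.
HONEST LABEL: HC_CM is proved only modulo the 7 printed citations (2 remaining named inputs: hLiu418 = stmt-HodgeConjecture-24832, h413 = stmt-HodgeConjecture-24833) until rung 0 closes;
this file is sign bookkeeping of an in-house theorem and pays nothing by itself.

## References
* [Rogawski1990] J. D. Rogawski, *Automorphic Representations of Unitary Groups in Three Variables*, Ann. of Math. Stud. 123 (1990), §8.2 Prop. 8.2.1 pp. 118–119, p. 123; §14.5
  Lemma 14.5.2 (b)(c) p. 238.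
* [Varadarajan1989] V. S. Varadarajan, *An Introduction to Harmonic Analysis on Semisimple Lie Groups* (1989), §6.4 Thm. 22.
-/

set_option autoImplicit false

noncomputable section

open MeasureTheory Matrix NumberField NumberField.InfinitePlace NumberField.mixedEmbedding Set Function Filter Topology
open scoped MatrixGroups ContDiff Real
open scoped Matrix.Norms.Operator

namespace Literature.NumberTheory.Automorphic.UnitaryGroup

section StepLaw

variable (L : Type) [Field L] [NumberField L] [IsCMField L] (α : Fin 2 → L)
  [∀ w : {w : InfinitePlace L // IsComplex w}, MeasurableSpace (archLocal L 2 (Matrix.diagonal α) w)]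
  [∀ w : {w : InfinitePlace L // IsComplex w}, BorelSpace (archLocal L 2 (Matrix.diagonal α) w)]
  (νw : ∀ w : {w : InfinitePlace L // IsComplex w}, Measure (archLocal L 2 (Matrix.diagonal α) w)) [∀ w, (νw w).IsHaarMeasure]
  (z : {w : InfinitePlace L // IsComplex w} → Circle)

open scoped Classical in
/-- **THE H-SIDE ONE-STEP LAW, DIRECT FORM, SIGNED (`C < 0`)** (the `r`-free reading of §2, = the `hstep` hypothesis of the joint place-induction engine ★ `K2E4ArchSingularKernelPlaceInduction.eq_of_step_of_regular_eq`
for the H-state family, K2E4-p09's «V1+» ask 2026-09-03T21:20:04Z).  At a complex place `w₁` (`σ_{w₁}α` real of opposite signs) there is ONE constant `C < 0` (Harish-Chandra's, ★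
`exists_tendsto_deriv_two_sin_smul_integral_integral_insert_neg` at `(L, α, w₁, νw w₁)`) such that for every smooth `Θ` with `g ↦ Θ ↑↑g` compactly supported, every `S ∋ w₁` and every `u` regular
on `S ∖ w₁`, the symmetrised mixed orbital integral along the central curve at `w₁` satisfies
`∂_ψ [2 sin ψ • Σ_ε ∫ Θ d(⊗ M(S, u[w₁ ↦ (z e^{iψ}, z e^{−iψ})], ε))] → C • Σ_ε ∫ Θ d(⊗ M(S ∖ w₁, u, ε))` as `ψ → 0`, `ψ ≠ 0`,
and the function is differentiable at every `0 < |ψ| < 1`.  (Mechanism of ★ p841432 §2: on `0 < |ψ| < 1` the function IS `Σ_ε [ε w₁ ? −g_ε(−ψ) : g_ε(ψ)]` with the engine's `g_ε`; differentiate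
termwise, `∂g_ε → C • V_ε` from both sides, `Σ_ε V_ε` = the descended integral.) [cite: Rogawski1990, §8.2 Prop. 8.2.1 pp. 118–119; §14.5 Lemma 14.5.2 (b)(c) p. 238] [cite: Varadarajan1989, §6.4 Thm. 22] -/
theorem exists_const_tendsto_deriv_two_sin_smul_sum_integral_pi_neg {E : Type*} [NormedAddCommGroup E] [NormedSpace ℝ E] [CompleteSpace E]
    (hα : ∀ i, α i ≠ 0) (w₁ : {w : InfinitePlace L // IsComplex w})
    (hreal : ∀ i, (w₁.1.embedding (α i)).im = 0) (hsgn : (w₁.1.embedding (α 0)).re * (w₁.1.embedding (α 1)).re < 0) :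
    ∃ C : ℝ, C < 0 ∧
      ∀ (Θ : Matrix (Fin 2) (Fin 2) (mixedSpace L) → E), ContDiff ℝ (⊤ : ℕ∞) Θ →
        HasCompactSupport (fun g : arch (↥(maximalRealSubfield L)) L (IsCMField.complexConj L) 2 (Matrix.diagonal α) =>
          Θ ((g : GL (Fin 2) (mixedSpace L)) : Matrix (Fin 2) (Fin 2) (mixedSpace L))) →
        ∀ (S : Finset {w : InfinitePlace L // IsComplex w}), w₁ ∈ S →
        ∀ (u : {w : InfinitePlace L // IsComplex w} → Fin 2 → Circle), (∀ w ∈ S, w ≠ w₁ → u w 0 ≠ u w 1) →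
        (∀ ψ ∈ Ioo (-1 : ℝ) 1, ψ ≠ 0 → DifferentiableAt ℝ (fun ψ : ℝ => (2 * Real.sin ψ) • ∑ ε : {w : InfinitePlace L // IsComplex w} → Bool,
          ∫ o, Θ (((((archPiEquivCM 2 L (Matrix.diagonal α)).symm o) : arch (↥(maximalRealSubfield L)) L (IsCMField.complexConj L) 2 (Matrix.diagonal α)) : GL (Fin 2) (mixedSpace L)) : Matrix (Fin 2) (Fin 2) (mixedSpace L))
              ∂(Measure.pi (fun w : {w : InfinitePlace L // IsComplex w} =>
              if w ∈ S then (νw w).map (fun g : archLocal L 2 (Matrix.diagonal α) w =>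
                g * ⟨circleDiagonal 2 (if ε w then (Function.update u w₁ ![z w₁ * Circle.exp ψ, z w₁ * Circle.exp (-ψ)]) w ∘ ⇑(Equiv.swap (0 : Fin 2) 1) else (Function.update u w₁ ![z w₁ * Circle.exp ψ, z w₁ * Circle.exp (-ψ)]) w), circleDiagonal_mem_archLocal_diagonal L 2 α w _⟩ * g⁻¹)
              else Measure.dirac (⟨circleDiagonal 2 ![z w, z w], circleDiagonal_mem_archLocal_diagonal L 2 α w _⟩ : archLocal L 2 (Matrix.diagonal α) w)))) ψ) ∧
        Tendsto (fun ψ : ℝ => deriv (fun ψ : ℝ => (2 * Real.sin ψ) • ∑ ε : {w : InfinitePlace L // IsComplex w} → Bool,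
          ∫ o, Θ (((((archPiEquivCM 2 L (Matrix.diagonal α)).symm o) : arch (↥(maximalRealSubfield L)) L (IsCMField.complexConj L) 2 (Matrix.diagonal α)) : GL (Fin 2) (mixedSpace L)) : Matrix (Fin 2) (Fin 2) (mixedSpace L))
              ∂(Measure.pi (fun w : {w : InfinitePlace L // IsComplex w} =>
              if w ∈ S then (νw w).map (fun g : archLocal L 2 (Matrix.diagonal α) w =>
                g * ⟨circleDiagonal 2 (if ε w then (Function.update u w₁ ![z w₁ * Circle.exp ψ, z w₁ * Circle.exp (-ψ)]) w ∘ ⇑(Equiv.swap (0 : Fin 2) 1) else (Function.update u w₁ ![z w₁ * Circle.exp ψ, z w₁ * Circle.exp (-ψ)]) w), circleDiagonal_mem_archLocal_diagonal L 2 α w _⟩ * g⁻¹)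
              else Measure.dirac (⟨circleDiagonal 2 ![z w, z w], circleDiagonal_mem_archLocal_diagonal L 2 α w _⟩ : archLocal L 2 (Matrix.diagonal α) w)))) ψ)
          (𝓝[≠] 0)
          (𝓝 (C • ∑ ε : {w : InfinitePlace L // IsComplex w} → Bool,
            ∫ o, Θ (((((archPiEquivCM 2 L (Matrix.diagonal α)).symm o) : arch (↥(maximalRealSubfield L)) L (IsCMField.complexConj L) 2 (Matrix.diagonal α)) : GL (Fin 2) (mixedSpace L)) : Matrix (Fin 2) (Fin 2) (mixedSpace L))
              ∂(Measure.pi (fun w : {w : InfinitePlace L // IsComplex w} =>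
              if w ∈ S.erase w₁ then (νw w).map (fun g : archLocal L 2 (Matrix.diagonal α) w =>
                g * ⟨circleDiagonal 2 (if ε w then u w ∘ ⇑(Equiv.swap (0 : Fin 2) 1) else u w), circleDiagonal_mem_archLocal_diagonal L 2 α w _⟩ * g⁻¹)
              else Measure.dirac (⟨circleDiagonal 2 ![z w, z w], circleDiagonal_mem_archLocal_diagonal L 2 α w _⟩ : archLocal L 2 (Matrix.diagonal α) w))))) := by
  haveI : ∀ w : {w : InfinitePlace L // IsComplex w}, SecondCountableTopology (archLocal L 2 (Matrix.diagonal α) w) := fun w => secondCountableTopology_archLocal L 2 (Matrix.diagonal α) w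
  haveI : ∀ w : {w : InfinitePlace L // IsComplex w}, LocallyCompactSpace (archLocal L 2 (Matrix.diagonal α) w) := fun w => locallyCompactSpace_archLocal L 2 (Matrix.diagonal α) w
  -- the engine at `w₁`: ONE constant for all other-place measures, all `Θ`, all `z`
  obtain ⟨C, hC, hlim⟩ := exists_tendsto_deriv_two_sin_smul_integral_integral_insert_neg (E := E) L α hα w₁ hreal hsgn (νw w₁)
  refine ⟨C, hC, ?_⟩
  intro Θ hΘ hΘc S hw₁ u hu
  -- regularity of `u` on `S ∖ w₁`; the families `M(S ∖ w₁, u, ε)` are Radon and σ-finite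
  have hu' : ∀ w ∈ S.erase w₁, u w 0 ≠ u w 1 := fun w hw => hu w (Finset.mem_of_mem_erase hw) (Finset.ne_of_mem_erase hw)
  haveI hR : ∀ (ε : {w : InfinitePlace L // IsComplex w} → Bool) (w : {w : InfinitePlace L // IsComplex w}), IsFiniteMeasureOnCompacts ((fun w : {w : InfinitePlace L // IsComplex w} =>
          if w ∈ S.erase w₁ then (νw w).map (fun g : archLocal L 2 (Matrix.diagonal α) w =>
            g * ⟨circleDiagonal 2 (if ε w then u w ∘ ⇑(Equiv.swap (0 : Fin 2) 1) else u w), circleDiagonal_mem_archLocal_diagonal L 2 α w _⟩ * g⁻¹)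
          else Measure.dirac (⟨circleDiagonal 2 ![z w, z w], circleDiagonal_mem_archLocal_diagonal L 2 α w _⟩ : archLocal L 2 (Matrix.diagonal α) w)) w) :=
    fun ε w => isFiniteMeasureOnCompacts_measureFamily L α νw z hα _ u hu' ε w
  haveI hσ : ∀ (ε : {w : InfinitePlace L // IsComplex w} → Bool) (w : {w : InfinitePlace L // IsComplex w}), SigmaFinite ((fun w : {w : InfinitePlace L // IsComplex w} =>
          if w ∈ S.erase w₁ then (νw w).map (fun g : archLocal L 2 (Matrix.diagonal α) w =>
            g * ⟨circleDiagonal 2 (if ε w then u w ∘ ⇑(Equiv.swap (0 : Fin 2) 1) else u w), circleDiagonal_mem_archLocal_diagonal L 2 α w _⟩ * g⁻¹)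
          else Measure.dirac (⟨circleDiagonal 2 ![z w, z w], circleDiagonal_mem_archLocal_diagonal L 2 α w _⟩ : archLocal L 2 (Matrix.diagonal α) w)) w) :=
    fun ε w => sigmaFinite_measureFamily L α νw z hα _ u hu' ε w
  -- the test function on `∏_w G_w`
  set F : (∀ w : {w : InfinitePlace L // IsComplex w}, archLocal L 2 (Matrix.diagonal α) w) → E := fun o => Θ (((((archPiEquivCM 2 L (Matrix.diagonal α)).symm o) : arch (↥(maximalRealSubfield L)) L (IsCMField.complexConj L) 2 (Matrix.diagonal α)) : GL (Fin 2) (mixedSpace L)) : Matrix (Fin 2) (Fin 2) (mixedSpace L)) with hF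
  obtain ⟨hFc, hFs⟩ := continuous_hasCompactSupport_comp_archPiEquivCM_symm L α Θ hΘ.continuous hΘc
  have hFm : StronglyMeasurable F := hFc.stronglyMeasurable
  -- the other-place families, blind to `ε w₁`
  set μ' : ({w : InfinitePlace L // IsComplex w} → Bool) → ∀ w' : {w : {w : InfinitePlace L // IsComplex w} // ¬ w = w₁}, Measure (archLocal L 2 (Matrix.diagonal α) w'.1) :=
    fun ε w' => (fun w : {w : InfinitePlace L // IsComplex w} =>
          if w ∈ S.erase w₁ then (νw w).map (fun g : archLocal L 2 (Matrix.diagonal α) w =>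
            g * ⟨circleDiagonal 2 (if ε w then u w ∘ ⇑(Equiv.swap (0 : Fin 2) 1) else u w), circleDiagonal_mem_archLocal_diagonal L 2 α w _⟩ * g⁻¹)
          else Measure.dirac (⟨circleDiagonal 2 ![z w, z w], circleDiagonal_mem_archLocal_diagonal L 2 α w _⟩ : archLocal L 2 (Matrix.diagonal α) w)) w'.1 with hμ'
  haveI : ∀ ε w', IsFiniteMeasureOnCompacts (μ' ε w') := fun ε w' => hR ε w'.1
  haveI : ∀ ε w', SigmaFinite (μ' ε w') := fun ε w' => hσ ε w'.1
  set g : ({w : InfinitePlace L // IsComplex w} → Bool) → ℝ → E := fun ε ψ => (2 * Real.sin ψ) •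
    ∫ k : archLocal L 2 (Matrix.diagonal α) w₁, ∫ o : (∀ w' : {w : {w : InfinitePlace L // IsComplex w} // ¬ w = w₁}, archLocal L 2 (Matrix.diagonal α) w'.1),
      Θ (((((archPiEquivCM 2 L (Matrix.diagonal α)).symm ((MeasurableEquiv.piEquivPiSubtypeProd (fun w : {w : InfinitePlace L // IsComplex w} => ↥(archLocal L 2 (Matrix.diagonal α) w)) (· = w₁)).symm
              ((MeasurableEquiv.piUnique fun i : {w : {w : InfinitePlace L // IsComplex w} // w = w₁} => ↥(archLocal L 2 (Matrix.diagonal α) i.1)).symm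
                (k * ⟨circleDiagonal 2 ![z w₁ * Circle.exp ψ, z w₁ * Circle.exp (-ψ)], circleDiagonal_mem_archLocal_diagonal L 2 α w₁ _⟩ * k⁻¹), o))) : arch (↥(maximalRealSubfield L)) L (IsCMField.complexConj L) 2 (Matrix.diagonal α)) : GL (Fin 2) (mixedSpace L)) : Matrix (Fin 2) (Fin 2) (mixedSpace L))
      ∂(Measure.pi (μ' ε)) ∂(νw w₁) with hg
  set V : ({w : InfinitePlace L // IsComplex w} → Bool) → E := fun ε =>
    ∫ o : (∀ w' : {w : {w : InfinitePlace L // IsComplex w} // ¬ w = w₁}, archLocal L 2 (Matrix.diagonal α) w'.1),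
      Θ (((((archPiEquivCM 2 L (Matrix.diagonal α)).symm ((MeasurableEquiv.piEquivPiSubtypeProd (fun w : {w : InfinitePlace L // IsComplex w} => ↥(archLocal L 2 (Matrix.diagonal α) w)) (· = w₁)).symm
              ((MeasurableEquiv.piUnique fun i : {w : {w : InfinitePlace L // IsComplex w} // w = w₁} => ↥(archLocal L 2 (Matrix.diagonal α) i.1)).symm
                ((⟨circleDiagonal 2 ![z w₁, z w₁], circleDiagonal_mem_archLocal_diagonal L 2 α w₁ _⟩ : archLocal L 2 (Matrix.diagonal α) w₁)), o))) : arch (↥(maximalRealSubfield L)) L (IsCMField.complexConj L) 2 (Matrix.diagonal α)) : GL (Fin 2) (mixedSpace L)) : Matrix (Fin 2) (Fin 2) (mixedSpace L))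
      ∂(Measure.pi (μ' ε)) with hV
  have hgl : ∀ ε, Tendsto (fun ψ : ℝ => deriv (g ε) ψ) (𝓝[≠] 0) (𝓝 (C • V ε)) ∧
      ∀ ψ ∈ Ioo (-1 : ℝ) 1, ψ ≠ 0 → DifferentiableAt ℝ (g ε) ψ := fun ε => hlim (μ' ε) Θ hΘ hΘc (z w₁)
  -- `V ε` is the Dirac-at-`w₁` integral over `M(S ∖ w₁, u, ε)`
  have hVint : ∀ ε, V ε = ∫ o, Θ (((((archPiEquivCM 2 L (Matrix.diagonal α)).symm o) : arch (↥(maximalRealSubfield L)) L (IsCMField.complexConj L) 2 (Matrix.diagonal α)) : GL (Fin 2) (mixedSpace L)) : Matrix (Fin 2) (Fin 2) (mixedSpace L))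
          ∂(Measure.pi (fun w : {w : InfinitePlace L // IsComplex w} =>
          if w ∈ S.erase w₁ then (νw w).map (fun g : archLocal L 2 (Matrix.diagonal α) w =>
            g * ⟨circleDiagonal 2 (if ε w then u w ∘ ⇑(Equiv.swap (0 : Fin 2) 1) else u w), circleDiagonal_mem_archLocal_diagonal L 2 α w _⟩ * g⁻¹)
          else Measure.dirac (⟨circleDiagonal 2 ![z w, z w], circleDiagonal_mem_archLocal_diagonal L 2 α w _⟩ : archLocal L 2 (Matrix.diagonal α) w))) := by
    intro ε
    have h1 : (∫ o, Θ (((((archPiEquivCM 2 L (Matrix.diagonal α)).symm o) : arch (↥(maximalRealSubfield L)) L (IsCMField.complexConj L) 2 (Matrix.diagonal α)) : GL (Fin 2) (mixedSpace L)) : Matrix (Fin 2) (Fin 2) (mixedSpace L))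
          ∂(Measure.pi (fun w : {w : InfinitePlace L // IsComplex w} =>
          if w ∈ S.erase w₁ then (νw w).map (fun g : archLocal L 2 (Matrix.diagonal α) w =>
            g * ⟨circleDiagonal 2 (if ε w then u w ∘ ⇑(Equiv.swap (0 : Fin 2) 1) else u w), circleDiagonal_mem_archLocal_diagonal L 2 α w _⟩ * g⁻¹)
          else Measure.dirac (⟨circleDiagonal 2 ![z w, z w], circleDiagonal_mem_archLocal_diagonal L 2 α w _⟩ : archLocal L 2 (Matrix.diagonal α) w)))) =
        ∫ o, F o ∂(Measure.pi (Function.update (fun w : {w : InfinitePlace L // IsComplex w} =>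
          if w ∈ S.erase w₁ then (νw w).map (fun g : archLocal L 2 (Matrix.diagonal α) w =>
            g * ⟨circleDiagonal 2 (if ε w then u w ∘ ⇑(Equiv.swap (0 : Fin 2) 1) else u w), circleDiagonal_mem_archLocal_diagonal L 2 α w _⟩ * g⁻¹)
          else Measure.dirac (⟨circleDiagonal 2 ![z w, z w], circleDiagonal_mem_archLocal_diagonal L 2 α w _⟩ : archLocal L 2 (Matrix.diagonal α) w)) w₁
          (Measure.dirac (⟨circleDiagonal 2 ![z w₁, z w₁], circleDiagonal_mem_archLocal_diagonal L 2 α w₁ _⟩ : archLocal L 2 (Matrix.diagonal α) w₁)))) := by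
      rw [← measureFamily_eq_update_dirac L α νw z (S.erase w₁) w₁ (Finset.notMem_erase w₁ S) u ε]
    rw [h1, integral_pi_update_dirac_archLocal L 2 α _ w₁ _ F (integrable_pi_update_of_hasCompactSupport _ w₁ _ F hFc hFs)]
  -- each term of the function, in the iterated currency: `2 sin ψ • ∫ Θ d(⊗ M(S, u_ψ, ε)) = g_ε(ψ)` or `−g_ε(−ψ)`
  have hI : ∀ ψ ∈ Ioo (-1 : ℝ) 1, ψ ≠ 0 → (2 * Real.sin ψ) • ∑ ε : {w : InfinitePlace L // IsComplex w} → Bool,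
      ∫ o, Θ (((((archPiEquivCM 2 L (Matrix.diagonal α)).symm o) : arch (↥(maximalRealSubfield L)) L (IsCMField.complexConj L) 2 (Matrix.diagonal α)) : GL (Fin 2) (mixedSpace L)) : Matrix (Fin 2) (Fin 2) (mixedSpace L))
          ∂(Measure.pi (fun w : {w : InfinitePlace L // IsComplex w} =>
          if w ∈ S then (νw w).map (fun g : archLocal L 2 (Matrix.diagonal α) w =>
            g * ⟨circleDiagonal 2 (if ε w then (Function.update u w₁ ![z w₁ * Circle.exp ψ, z w₁ * Circle.exp (-ψ)]) w ∘ ⇑(Equiv.swap (0 : Fin 2) 1) else (Function.update u w₁ ![z w₁ * Circle.exp ψ, z w₁ * Circle.exp (-ψ)]) w), circleDiagonal_mem_archLocal_diagonal L 2 α w _⟩ * g⁻¹)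
          else Measure.dirac (⟨circleDiagonal 2 ![z w, z w], circleDiagonal_mem_archLocal_diagonal L 2 α w _⟩ : archLocal L 2 (Matrix.diagonal α) w))) =
      ∑ ε : {w : InfinitePlace L // IsComplex w} → Bool, (if ε w₁ then -(g ε (-ψ)) else g ε ψ) := by
    intro ψ hψ hψ0
    rw [Finset.smul_sum]
    refine Finset.sum_congr rfl fun ε _ => ?_
    have hreg : z w₁ * Circle.exp ψ ≠ z w₁ * Circle.exp (-ψ) := mul_exp_ne_mul_exp_neg (z w₁) hψ hψ0
    have hinj : Function.Injective (if ε w₁ then ![z w₁ * Circle.exp ψ, z w₁ * Circle.exp (-ψ)] ∘ ⇑(Equiv.swap (0 : Fin 2) 1) else ![z w₁ * Circle.exp ψ, z w₁ * Circle.exp (-ψ)]) := by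
      split_ifs
      · exact injective_of_apply_zero_ne_apply_one _ (comp_swap_apply_zero_ne _ hreg)
      · exact injective_of_apply_zero_ne_apply_one _ hreg
    haveI := isFiniteMeasureOnCompacts_map_conj_circleDiagonal L 2 α w₁ hα _ hinj (νw w₁)
    haveI := sigmaFinite_map_conj_circleDiagonal L 2 α w₁ hα _ hinj (νw w₁)
    rw [measureFamily_update_eq_update L α νw z S w₁ hw₁ u _ ε,
      show (∫ o, Θ (((((archPiEquivCM 2 L (Matrix.diagonal α)).symm o) : arch (↥(maximalRealSubfield L)) L (IsCMField.complexConj L) 2 (Matrix.diagonal α)) : GL (Fin 2) (mixedSpace L)) : Matrix (Fin 2) (Fin 2) (mixedSpace L))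
        ∂(Measure.pi (Function.update (fun w : {w : InfinitePlace L // IsComplex w} =>
          if w ∈ S.erase w₁ then (νw w).map (fun g : archLocal L 2 (Matrix.diagonal α) w =>
            g * ⟨circleDiagonal 2 (if ε w then u w ∘ ⇑(Equiv.swap (0 : Fin 2) 1) else u w), circleDiagonal_mem_archLocal_diagonal L 2 α w _⟩ * g⁻¹)
          else Measure.dirac (⟨circleDiagonal 2 ![z w, z w], circleDiagonal_mem_archLocal_diagonal L 2 α w _⟩ : archLocal L 2 (Matrix.diagonal α) w)) w₁
          ((νw w₁).map (fun g : archLocal L 2 (Matrix.diagonal α) w₁ =>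
            g * ⟨circleDiagonal 2 (if ε w₁ then ![z w₁ * Circle.exp ψ, z w₁ * Circle.exp (-ψ)] ∘ ⇑(Equiv.swap (0 : Fin 2) 1) else ![z w₁ * Circle.exp ψ, z w₁ * Circle.exp (-ψ)]),
              circleDiagonal_mem_archLocal_diagonal L 2 α w₁ _⟩ * g⁻¹))))) = ∫ o, F o ∂_ from rfl,
      integral_pi_update_map_conj_circleDiagonal_archLocal L 2 α _ w₁ _ (νw w₁) F hFm
        (integrable_pi_update_of_hasCompactSupport _ w₁ _ F hFc hFs)]
    cases hb : ε w₁
    · simp only [Bool.false_eq_true, ↓reduceIte, hg, hF, hμ']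
    · simp only [↓reduceIte, hg, hF, hμ', comp_swap_eq, Real.sin_neg, mul_neg, neg_smul, neg_neg]
  -- the flipped terms are differentiable on `0 < |ψ| < 1` with the symmetric derivative
  have hderivG : ∀ ψ ∈ Ioo (-1 : ℝ) 1, ψ ≠ 0 →
      HasDerivAt (fun ψ : ℝ => ∑ ε : {w : InfinitePlace L // IsComplex w} → Bool, (if ε w₁ then -(g ε (-ψ)) else g ε ψ))
        (∑ ε : {w : InfinitePlace L // IsComplex w} → Bool, (if ε w₁ then deriv (g ε) (-ψ) else deriv (g ε) ψ)) ψ := by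
    intro ψ hψ hψ0
    have hneg : -ψ ∈ Ioo (-1 : ℝ) 1 := by
      simp only [mem_Ioo] at hψ ⊢
      constructor <;> linarith [hψ.1, hψ.2]
    have hψ0' : -ψ ≠ 0 := neg_ne_zero.2 hψ0
    refine HasDerivAt.fun_sum fun ε _ => ?_
    cases hb : ε w₁
    · simp only [Bool.false_eq_true, ↓reduceIte]
      exact ((hgl ε).2 ψ hψ hψ0).hasDerivAt
    · simp only [↓reduceIte]
      have hg1 : HasDerivAt (g ε) (deriv (g ε) (-ψ)) (-ψ) := ((hgl ε).2 (-ψ) hneg hψ0').hasDerivAt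
      have h2 : HasDerivAt (fun ψ : ℝ => g ε (-ψ)) ((-1 : ℝ) • deriv (g ε) (-ψ)) ψ := hg1.scomp ψ (hasDerivAt_neg ψ)
      have h3 := h2.neg
      simp only [neg_smul, one_smul, neg_neg] at h3
      exact h3
  -- the open punctured window and the identification of the function there
  have hIoo : ∀ᶠ ψ : ℝ in 𝓝[≠] 0, ψ ∈ Ioo (-1 : ℝ) 1 ∧ ψ ≠ 0 :=
    Filter.inter_mem (mem_nhdsWithin_of_mem_nhds (Ioo_mem_nhds (by norm_num) (by norm_num))) self_mem_nhdsWithin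
  have hopen : IsOpen (Ioo (-1 : ℝ) 1 ∩ {(0 : ℝ)}ᶜ) := isOpen_Ioo.inter isOpen_compl_singleton
  have hlocal : ∀ ψ ∈ Ioo (-1 : ℝ) 1, ψ ≠ 0 → (fun ψ : ℝ => (2 * Real.sin ψ) • ∑ ε : {w : InfinitePlace L // IsComplex w} → Bool,
      ∫ o, Θ (((((archPiEquivCM 2 L (Matrix.diagonal α)).symm o) : arch (↥(maximalRealSubfield L)) L (IsCMField.complexConj L) 2 (Matrix.diagonal α)) : GL (Fin 2) (mixedSpace L)) : Matrix (Fin 2) (Fin 2) (mixedSpace L))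
          ∂(Measure.pi (fun w : {w : InfinitePlace L // IsComplex w} =>
          if w ∈ S then (νw w).map (fun g : archLocal L 2 (Matrix.diagonal α) w =>
            g * ⟨circleDiagonal 2 (if ε w then (Function.update u w₁ ![z w₁ * Circle.exp ψ, z w₁ * Circle.exp (-ψ)]) w ∘ ⇑(Equiv.swap (0 : Fin 2) 1) else (Function.update u w₁ ![z w₁ * Circle.exp ψ, z w₁ * Circle.exp (-ψ)]) w), circleDiagonal_mem_archLocal_diagonal L 2 α w _⟩ * g⁻¹)
          else Measure.dirac (⟨circleDiagonal 2 ![z w, z w], circleDiagonal_mem_archLocal_diagonal L 2 α w _⟩ : archLocal L 2 (Matrix.diagonal α) w)))) =ᶠ[𝓝 ψ]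
      (fun ψ : ℝ => ∑ ε : {w : InfinitePlace L // IsComplex w} → Bool, (if ε w₁ then -(g ε (-ψ)) else g ε ψ)) := by
    intro ψ hψ hψ0
    filter_upwards [hopen.mem_nhds ⟨hψ, hψ0⟩] with y hy
    exact hI y hy.1 hy.2
  refine ⟨fun ψ hψ hψ0 => ((hlocal ψ hψ hψ0).differentiableAt_iff).2 (hderivG ψ hψ hψ0).differentiableAt, ?_⟩
  -- the derivative on the punctured window, and its limit
  have hderiv_eq : (fun ψ : ℝ => deriv (fun ψ : ℝ => (2 * Real.sin ψ) • ∑ ε : {w : InfinitePlace L // IsComplex w} → Bool,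
      ∫ o, Θ (((((archPiEquivCM 2 L (Matrix.diagonal α)).symm o) : arch (↥(maximalRealSubfield L)) L (IsCMField.complexConj L) 2 (Matrix.diagonal α)) : GL (Fin 2) (mixedSpace L)) : Matrix (Fin 2) (Fin 2) (mixedSpace L))
          ∂(Measure.pi (fun w : {w : InfinitePlace L // IsComplex w} =>
          if w ∈ S then (νw w).map (fun g : archLocal L 2 (Matrix.diagonal α) w =>
            g * ⟨circleDiagonal 2 (if ε w then (Function.update u w₁ ![z w₁ * Circle.exp ψ, z w₁ * Circle.exp (-ψ)]) w ∘ ⇑(Equiv.swap (0 : Fin 2) 1) else (Function.update u w₁ ![z w₁ * Circle.exp ψ, z w₁ * Circle.exp (-ψ)]) w), circleDiagonal_mem_archLocal_diagonal L 2 α w _⟩ * g⁻¹)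
          else Measure.dirac (⟨circleDiagonal 2 ![z w, z w], circleDiagonal_mem_archLocal_diagonal L 2 α w _⟩ : archLocal L 2 (Matrix.diagonal α) w)))) ψ) =ᶠ[𝓝[≠] (0 : ℝ)]
      fun ψ : ℝ => ∑ ε : {w : InfinitePlace L // IsComplex w} → Bool, (if ε w₁ then deriv (g ε) (-ψ) else deriv (g ε) ψ) := by
    filter_upwards [hIoo] with ψ hψ
    rw [(hlocal ψ hψ.1 hψ.2).deriv_eq, (hderivG ψ hψ.1 hψ.2).deriv]
  rw [Filter.tendsto_congr' hderiv_eq]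
  have hsumV : C • ∑ ε : {w : InfinitePlace L // IsComplex w} → Bool,
      ∫ o, Θ (((((archPiEquivCM 2 L (Matrix.diagonal α)).symm o) : arch (↥(maximalRealSubfield L)) L (IsCMField.complexConj L) 2 (Matrix.diagonal α)) : GL (Fin 2) (mixedSpace L)) : Matrix (Fin 2) (Fin 2) (mixedSpace L))
          ∂(Measure.pi (fun w : {w : InfinitePlace L // IsComplex w} =>
          if w ∈ S.erase w₁ then (νw w).map (fun g : archLocal L 2 (Matrix.diagonal α) w =>
            g * ⟨circleDiagonal 2 (if ε w then u w ∘ ⇑(Equiv.swap (0 : Fin 2) 1) else u w), circleDiagonal_mem_archLocal_diagonal L 2 α w _⟩ * g⁻¹)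
          else Measure.dirac (⟨circleDiagonal 2 ![z w, z w], circleDiagonal_mem_archLocal_diagonal L 2 α w _⟩ : archLocal L 2 (Matrix.diagonal α) w))) =
      ∑ ε : {w : InfinitePlace L // IsComplex w} → Bool, C • V ε := by
    rw [Finset.smul_sum]
    exact Finset.sum_congr rfl fun ε _ => by rw [hVint ε]
  rw [hsumV]
  refine tendsto_finsetSum _ fun ε _ => ?_
  cases hb : ε w₁
  · simp only [Bool.false_eq_true, ↓reduceIte]
    exact (hgl ε).1
  · simp only [↓reduceIte]
    exact (hgl ε).1.comp tendsto_neg_nhdsWithin_ne_zero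

open scoped Classical in
/-- **THE H-SIDE ONE-STEP LAW AT EVERY PLACE, ONE FAMILY OF NEGATIVE CONSTANTS** (K2E4-p09's «V1+» binder shape, 2026-09-03T21:20:04Z): `∃ C : W → ℝ`, all `< 0`, such that for every smooth compactly
supported `Θ`, every `S ∋ w₁` and every `u` regular on `S ∖ w₁`, `∂_ψ[2 sin ψ • I(S, u[w₁ ↦ (z e^{iψ}, z e^{−iψ})])] → C_{w₁} • I(S ∖ w₁, u)` along `𝓝[≠] 0` — the `hstep` of ★
`K2E4ArchSingularKernelPlaceInduction.eq_of_step_of_regular_eq` for the H-state family `A S u := κ • (∏_{w ∈ S} C_w) • I(univ ∖ S, u)` of the #9 assembly.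
[cite: Rogawski1990, §8.2 Prop. 8.2.1 pp. 118–119; §14.5 Lemma 14.5.2 (b)(c) p. 238] [cite: Varadarajan1989, §6.4 Thm. 22] -/
theorem exists_const_forall_tendsto_deriv_two_sin_smul_sum_integral_pi_neg {E : Type*} [NormedAddCommGroup E] [NormedSpace ℝ E] [CompleteSpace E]
    (hα : ∀ i, α i ≠ 0)
    (hreal : ∀ (w : {w : InfinitePlace L // IsComplex w}) (i : Fin 2), (w.1.embedding (α i)).im = 0)
    (hsgn : ∀ w : {w : InfinitePlace L // IsComplex w}, (w.1.embedding (α 0)).re * (w.1.embedding (α 1)).re < 0) :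
    ∃ C : {w : InfinitePlace L // IsComplex w} → ℝ, (∀ w, C w < 0) ∧
      ∀ (Θ : Matrix (Fin 2) (Fin 2) (mixedSpace L) → E), ContDiff ℝ (⊤ : ℕ∞) Θ →
        HasCompactSupport (fun g : arch (↥(maximalRealSubfield L)) L (IsCMField.complexConj L) 2 (Matrix.diagonal α) =>
          Θ ((g : GL (Fin 2) (mixedSpace L)) : Matrix (Fin 2) (Fin 2) (mixedSpace L))) →
        ∀ (S : Finset {w : InfinitePlace L // IsComplex w}) (w₁ : {w : InfinitePlace L // IsComplex w}), w₁ ∈ S →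
        ∀ (u : {w : InfinitePlace L // IsComplex w} → Fin 2 → Circle), (∀ w ∈ S, w ≠ w₁ → u w 0 ≠ u w 1) →
        Tendsto (fun ψ : ℝ => deriv (fun ψ : ℝ => (2 * Real.sin ψ) • ∑ ε : {w : InfinitePlace L // IsComplex w} → Bool,
          ∫ o, Θ (((((archPiEquivCM 2 L (Matrix.diagonal α)).symm o) : arch (↥(maximalRealSubfield L)) L (IsCMField.complexConj L) 2 (Matrix.diagonal α)) : GL (Fin 2) (mixedSpace L)) : Matrix (Fin 2) (Fin 2) (mixedSpace L))
              ∂(Measure.pi (fun w : {w : InfinitePlace L // IsComplex w} =>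
              if w ∈ S then (νw w).map (fun g : archLocal L 2 (Matrix.diagonal α) w =>
                g * ⟨circleDiagonal 2 (if ε w then (Function.update u w₁ ![z w₁ * Circle.exp ψ, z w₁ * Circle.exp (-ψ)]) w ∘ ⇑(Equiv.swap (0 : Fin 2) 1) else (Function.update u w₁ ![z w₁ * Circle.exp ψ, z w₁ * Circle.exp (-ψ)]) w), circleDiagonal_mem_archLocal_diagonal L 2 α w _⟩ * g⁻¹)
              else Measure.dirac (⟨circleDiagonal 2 ![z w, z w], circleDiagonal_mem_archLocal_diagonal L 2 α w _⟩ : archLocal L 2 (Matrix.diagonal α) w)))) ψ)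
          (𝓝[≠] 0)
          (𝓝 (C w₁ • ∑ ε : {w : InfinitePlace L // IsComplex w} → Bool,
            ∫ o, Θ (((((archPiEquivCM 2 L (Matrix.diagonal α)).symm o) : arch (↥(maximalRealSubfield L)) L (IsCMField.complexConj L) 2 (Matrix.diagonal α)) : GL (Fin 2) (mixedSpace L)) : Matrix (Fin 2) (Fin 2) (mixedSpace L))
              ∂(Measure.pi (fun w : {w : InfinitePlace L // IsComplex w} =>
              if w ∈ S.erase w₁ then (νw w).map (fun g : archLocal L 2 (Matrix.diagonal α) w =>
                g * ⟨circleDiagonal 2 (if ε w then u w ∘ ⇑(Equiv.swap (0 : Fin 2) 1) else u w), circleDiagonal_mem_archLocal_diagonal L 2 α w _⟩ * g⁻¹)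
              else Measure.dirac (⟨circleDiagonal 2 ![z w, z w], circleDiagonal_mem_archLocal_diagonal L 2 α w _⟩ : archLocal L 2 (Matrix.diagonal α) w))))) := by
  have hstep := fun w₁ : {w : InfinitePlace L // IsComplex w} =>
    exists_const_tendsto_deriv_two_sin_smul_sum_integral_pi_neg (E := E) L α νw z hα w₁ (hreal w₁) (hsgn w₁)
  choose C hC hS using hstep
  exact ⟨C, hC, fun Θ hΘ hΘc S w₁ hw₁ u hu => (hS w₁ Θ hΘ hΘc S hw₁ u hu).2⟩

end StepLaw

end Literature.NumberTheory.Automorphic.UnitaryGroup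

end
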